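import Mathlib
import HarnessLib
import Summits.Parity.Statement
import Summits.Parity.BatemanHorn.Theses.OneSidedDegreeLadder
import Summits.Parity.BatemanHorn.Theses.DegreeExcessLadder
import Summits.Parity.BatemanHorn.Theorems.LowerNonlinearGlue
import Literature.NumberTheory.Sieve.BatemanHornProofs
import Literature.NumberTheory.Sieve.BatemanHornAlmostPrimes
import Literature.NumberTheory.Sieve.HardyLittlewoodProofs
import Literature.NumberTheory.Sieve.ParityWave0BunyakovskyProofs

/-!
# Route `DegreeExcessLadder` — the PROVED rung beneath the piece `SinglePg` (hand (b), THEOREMS ONLY)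

decomp-parity node B1.2 «DegreeExcessLadder» (lens-1 g7 kernel `HOME/decomp-parity-lens-1/g7/DegreeExcessLadder.lean`
§2/§5, critic CLEARED CRITIC-LEDGER rows 83 / 87a; route `route-Parity-DegreeExcessLadder` rev 1 d59967a8ab45),
RE-POINTED at the born module `Summits.Parity.BatemanHorn.Theses.DegreeExcessLadder` by lens-1 g8 (writer LANDING
LIST L6), with the kernel's grade predicate `SingleExcess g e` INLINED (D-0026: no `def … : Prop` in a hand):

  «grade `(g, e)`» := for every single Bateman–Horn polynomial `f` of degree `g` there is `θ > 0` with
  `θ · C(f)/g · x/log x ≤ #{n ≤ x : f(n) > 1, Ω(f(n)) ≤ e + 1}` eventually.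

* `grade_rung` — **the BC5 / T3 witness IN THE TREE**: on every degree-`g` cell SOME excess `e(g)` is a THEOREM,
  from the tree's PROVED fundamental-lemma theorem `BatemanHornAlmostPrimes.batemanHorn_almostPrimes`;
* `singlePg_iff_diagonalGrade` — the born piece `SinglePg` (stmt-Parity-32513) IS the diagonal grade `e = g − 1`
  on every cell of degree `≥ 3`;
* `grade_mono`, `chenRest_shadow_gradeOne`, `rung_below_singlePg` — the position shadow (`e = 1`, from the parent
  leaf `ChenRest`) ≤ piece (`e = g − 1`) on the single-cell ladder, and the proved rung below the piece.

No `sorry`, standard axioms; the items `SinglePg` / `ExcessLift` themselves get NO prover time (critic P1).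
-/

open Filter Finset Polynomial Asymptotics
open scoped Topology

open Literature.NumberTheory.Sieve

namespace Summit.Parity.BatemanHorn.Theses.DegreeExcessLadder

/-! ## Helpers for a single Bateman–Horn polynomial -/

/-- Eventually a single Bateman–Horn polynomial exceeds `1` at `n` (tree: `tendsto_eval_natCast_atTop`). -/
theorem eventually_one_lt_eval {f : ℤ[X]} (hf : IsBatemanHornSystem ![f]) :
    ∀ᶠ n : ℕ in atTop, 1 < f.eval (n : ℤ) := by
  have hd : 1 ≤ f.natDegree := by
    have := hf.natDegree_pos 0
    simp at this
    omega
  have hl : 0 < f.leadingCoeff := by simpa using hf.leadingCoeff_pos 0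
  exact (Literature.NumberTheory.Sieve.tendsto_eval_natCast_atTop hd hl).eventually (eventually_gt_atTop 1)

/-- `C(f) · x/log x → ∞` for a single Bateman–Horn polynomial (`C(f) > 0` is PROVED in the tree,
`IsBatemanHornSystem.hasBatemanHornConst_holds`; `x/log x → ∞` is the tree's `tendsto_natCast_div_log_pow_atTop`). -/
theorem tendsto_bhConst_mul_div_log_atTop {f : ℤ[X]} (hf : IsBatemanHornSystem ![f]) :
    Tendsto (fun x : ℕ => batemanHornConst ![f] * (x : ℝ) / Real.log x) atTop atTop := by
  have hC : 0 < batemanHornConst ![f] := (IsBatemanHornSystem.hasBatemanHornConst_holds hf).2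
  refine ((Literature.NumberTheory.Sieve.tendsto_natCast_div_log_pow_atTop 1).const_mul_atTop hC).congr fun x => ?_
  simp only [pow_one]
  ring

/-! ## The proved rung: some excess on every cell -/

/-- **RUNG (BC5 / T3 witness, from the tree's PROVED theorem `BatemanHornAlmostPrimes.batemanHorn_almostPrimes`):**
on EVERY degree-`g` cell some excess `e = e(g)` holds at a positive Bateman–Horn proportion — for every single
Bateman–Horn polynomial `f` of degree `g`, some `θ > 0` has
`θ · C(f)/g · x/log x ≤ #{n ≤ x : f(n) > 1, Ω(f(n)) ≤ e + 1}` eventually.  The single-cell ladder thus has a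
PROVED grade strictly between the trivial region and the piece `SinglePg` (= grade `g − 1`; print = grade `g`,
Richert). -/
theorem grade_rung (g : ℕ) : ∃ e : ℕ, ∀ f : ℤ[X], IsBatemanHornSystem ![f] → f.natDegree = g →
    ∃ θ : ℝ, 0 < θ ∧ ∀ᶠ x : ℕ in atTop,
      θ * (batemanHornConst ![f] / (f.natDegree : ℝ) * (x : ℝ) / Real.log x) ≤
        (((Finset.range (x + 1)).filter fun n : ℕ =>
          1 < f.eval (n : ℤ) ∧ ArithmeticFunction.cardFactors ((f.eval (n : ℤ)).toNat) ≤ e + 1).card : ℝ) := by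
  classical
  obtain ⟨r, c, hc, H⟩ := BatemanHornAlmostPrimes.batemanHorn_almostPrimes 1 ![g]
  refine ⟨r, fun f hf hdeg => ⟨c / 2, by positivity, ?_⟩⟩
  obtain ⟨n₀, hn₀⟩ := eventually_atTop.mp (eventually_one_lt_eval hf)
  have hC : 0 < batemanHornConst ![f] := (IsBatemanHornSystem.hasBatemanHornConst_holds hf).2
  have hg1 : (1 : ℝ) ≤ (f.natDegree : ℝ) := by
    have := hf.natDegree_pos 0
    simp at this
    exact_mod_cast this
  have hM := (tendsto_bhConst_mul_div_log_atTop hf).eventually_ge_atTop (2 * (n₀ : ℝ) / c)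
  have hdeg' : ∀ i : Fin 1, ((![f] : Fin 1 → ℤ[X]) i).natDegree = (![g] : Fin 1 → ℕ) i := by
    intro i
    rw [Fin.fin_one_eq_zero i]
    simpa using hdeg
  filter_upwards [H ![f] hf hdeg', hM] with x hx hMx
  -- (i) the tree's count sits inside ours up to the finitely many `n < n₀`
  have hcount : (((range (x + 1)).filter fun n : ℕ =>
      (∏ i : Fin 1, ((![f] : Fin 1 → ℤ[X]) i).eval (n : ℤ)) ≠ 0 ∧
        Nat.IsAtMostAlmostPrime r (∏ i : Fin 1, ((![f] : Fin 1 → ℤ[X]) i).eval (n : ℤ)).natAbs).card : ℝ) ≤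
      (((Finset.range (x + 1)).filter fun n : ℕ =>
          1 < f.eval (n : ℤ) ∧ ArithmeticFunction.cardFactors ((f.eval (n : ℤ)).toNat) ≤ r + 1).card : ℝ) + n₀ := by
    have hsub : ((range (x + 1)).filter fun n : ℕ =>
        (∏ i : Fin 1, ((![f] : Fin 1 → ℤ[X]) i).eval (n : ℤ)) ≠ 0 ∧
          Nat.IsAtMostAlmostPrime r (∏ i : Fin 1, ((![f] : Fin 1 → ℤ[X]) i).eval (n : ℤ)).natAbs) ⊆
        ((range (x + 1)).filter fun n : ℕ =>
          1 < f.eval (n : ℤ) ∧ ArithmeticFunction.cardFactors ((f.eval (n : ℤ)).toNat) ≤ r + 1) ∪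
          range n₀ := by
      intro n hn
      rw [Finset.mem_filter] at hn
      simp only [Fin.prod_univ_one, Matrix.cons_val_zero] at hn
      rw [Finset.mem_union, Finset.mem_filter]
      by_cases hlt : n < n₀
      · exact Or.inr (Finset.mem_range.mpr hlt)
      · have h1 := hn₀ n (not_lt.mp hlt)
        refine Or.inl ⟨hn.1, h1, ?_⟩
        have hnn : 0 ≤ f.eval (n : ℤ) := by linarith
        have htn : (f.eval (n : ℤ)).toNat = (f.eval (n : ℤ)).natAbs := by
          have e1 : (((f.eval (n : ℤ)).toNat : ℕ) : ℤ) = f.eval (n : ℤ) := Int.toNat_of_nonneg hnn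
          have e2 : (((f.eval (n : ℤ)).natAbs : ℕ) : ℤ) = f.eval (n : ℤ) := Int.natAbs_of_nonneg hnn
          exact_mod_cast e1.trans e2.symm
        rw [htn]
        exact hn.2.2.2.trans (Nat.le_succ r)
    have h2 := (Finset.card_le_card hsub).trans (Finset.card_union_le _ _)
    rw [Finset.card_range] at h2
    exact_mod_cast h2
  -- (ii) main-term algebra
  have hMx' : (n₀ : ℝ) ≤ c / 2 * (batemanHornConst ![f] * x / Real.log x) := by
    rw [div_le_iff₀ hc] at hMx
    nlinarith
  have hle1 : c / 2 * (batemanHornConst ![f] / (f.natDegree : ℝ) * x / Real.log x) ≤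
      c / 2 * (batemanHornConst ![f] * x / Real.log x) := by
    have hxL : 0 ≤ (x : ℝ) / Real.log x := by
      have : 0 ≤ Real.log (x : ℝ) := Real.log_natCast_nonneg x
      positivity
    have : batemanHornConst ![f] / (f.natDegree : ℝ) * x / Real.log x ≤
        batemanHornConst ![f] * x / Real.log x := by
      calc batemanHornConst ![f] / (f.natDegree : ℝ) * x / Real.log x
          = batemanHornConst ![f] / (f.natDegree : ℝ) * (x / Real.log x) := by ring
        _ ≤ batemanHornConst ![f] * (x / Real.log x) := by gcongr; exact div_le_self hC.le hg1
        _ = batemanHornConst ![f] * x / Real.log x := by ring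
    gcongr
  have hx' : c * batemanHornConst ![f] * (x : ℝ) / Real.log x ^ 1 =
      2 * (c / 2 * (batemanHornConst ![f] * x / Real.log x)) := by rw [pow_one]; ring
  rw [hx'] at hx
  linarith [hcount, hx, hle1, hMx']

/-! ## The piece and the parent's shadow on the single-cell ladder -/

/-- The single-cell ladder is monotone in the excess `e`. -/
theorem grade_mono {g e e' : ℕ} (h : e ≤ e')
    (he : ∀ f : ℤ[X], IsBatemanHornSystem ![f] → f.natDegree = g →
      ∃ θ : ℝ, 0 < θ ∧ ∀ᶠ x : ℕ in atTop,
        θ * (batemanHornConst ![f] / (f.natDegree : ℝ) * (x : ℝ) / Real.log x) ≤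
          (((Finset.range (x + 1)).filter fun n : ℕ =>
            1 < f.eval (n : ℤ) ∧ ArithmeticFunction.cardFactors ((f.eval (n : ℤ)).toNat) ≤ e + 1).card : ℝ)) :
    ∀ f : ℤ[X], IsBatemanHornSystem ![f] → f.natDegree = g →
      ∃ θ : ℝ, 0 < θ ∧ ∀ᶠ x : ℕ in atTop,
        θ * (batemanHornConst ![f] / (f.natDegree : ℝ) * (x : ℝ) / Real.log x) ≤
          (((Finset.range (x + 1)).filter fun n : ℕ =>
            1 < f.eval (n : ℤ) ∧ ArithmeticFunction.cardFactors ((f.eval (n : ℤ)).toNat) ≤ e' + 1).card : ℝ) := by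
  intro f hf hdeg
  obtain ⟨θ, hθ, hev⟩ := he f hf hdeg
  refine ⟨θ, hθ, ?_⟩
  filter_upwards [hev] with x hx
  refine hx.trans ?_
  exact_mod_cast Finset.card_le_card fun n hn => by
    rw [Finset.mem_filter] at hn ⊢
    exact ⟨hn.1, hn.2.1, hn.2.2.trans (by omega)⟩

/-- **The born piece IS the diagonal grade:** `SinglePg` (stmt-Parity-32513) ⟺ grade `e = g − 1` on every cell of
degree `g ≥ 3`. -/
theorem singlePg_iff_diagonalGrade :
    SinglePg ↔ ∀ g : ℕ, 3 ≤ g → ∀ f : ℤ[X], IsBatemanHornSystem ![f] → f.natDegree = g →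
      ∃ θ : ℝ, 0 < θ ∧ ∀ᶠ x : ℕ in atTop,
        θ * (batemanHornConst ![f] / (f.natDegree : ℝ) * (x : ℝ) / Real.log x) ≤
          (((Finset.range (x + 1)).filter fun n : ℕ =>
            1 < f.eval (n : ℤ) ∧ ArithmeticFunction.cardFactors ((f.eval (n : ℤ)).toNat) ≤ (g - 1) + 1).card : ℝ) := by
  constructor
  · intro hS g hg f hf hdeg
    obtain ⟨θ, hθ, hev⟩ := hS f hf (hdeg ▸ hg)
    refine ⟨θ, hθ, ?_⟩
    filter_upwards [hev] with x hx
    refine hx.trans_eq ?_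
    congr 2
    ext n
    simp only [Finset.mem_filter, Finset.mem_range]
    constructor
    · rintro ⟨h1, h2, h3⟩; exact ⟨h1, h2, by omega⟩
    · rintro ⟨h1, h2, h3⟩; exact ⟨h1, h2, by omega⟩
  · intro h f hf hg
    obtain ⟨θ, hθ, hev⟩ := h f.natDegree hg f hf rfl
    refine ⟨θ, hθ, ?_⟩
    filter_upwards [hev] with x hx
    refine hx.trans_eq ?_
    congr 2
    ext n
    simp only [Finset.mem_filter, Finset.mem_range]
    constructor
    · rintro ⟨h1, h2, h3⟩; exact ⟨h1, h2, by omega⟩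
    · rintro ⟨h1, h2, h3⟩; exact ⟨h1, h2, by omega⟩

/-- **The parent's shadow:** `ChenRest` (stmt-Parity-26566) gives grade `e = 1` on every single cell of degree `≥ 3`
(proportion `1 − ε` relaxed to `1/2`). -/
theorem chenRest_shadow_gradeOne (hR : OneSidedDegreeLadder.ChenRest) (g : ℕ) (hg : 3 ≤ g) :
    ∀ f : ℤ[X], IsBatemanHornSystem ![f] → f.natDegree = g →
      ∃ θ : ℝ, 0 < θ ∧ ∀ᶠ x : ℕ in atTop,
        θ * (batemanHornConst ![f] / (f.natDegree : ℝ) * (x : ℝ) / Real.log x) ≤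
          (((Finset.range (x + 1)).filter fun n : ℕ =>
            1 < f.eval (n : ℤ) ∧ ArithmeticFunction.cardFactors ((f.eval (n : ℤ)).toNat) ≤ 1 + 1).card : ℝ) := by
  intro f hf hdeg
  have hex : ∃ i : Fin 1, 2 ≤ ((![f] : Fin 1 → ℤ[X]) i).natDegree := ⟨0, by simp; omega⟩
  have hnq : ¬ (1 = 1 ∧ ∀ i : Fin 1, ((![f] : Fin 1 → ℤ[X]) i).natDegree = 2) := by
    rintro ⟨-, h⟩
    have := h 0
    simp at this
    omega
  refine ⟨1 / 2, by norm_num, ?_⟩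
  filter_upwards [hR 1 ![f] hf hex hnq (1 / 2) (by norm_num)] with x hx
  have e1 : batemanHornConst ![f] / (∏ i : Fin 1, (((![f] : Fin 1 → ℤ[X]) i).natDegree : ℝ)) * (x : ℝ) /
      Real.log x ^ 1 = batemanHornConst ![f] / (f.natDegree : ℝ) * (x : ℝ) / Real.log x := by
    simp
  rw [e1, OneSidedDegreeLadder.LowerNonlinearGlue.count_single] at hx
  have h12 : (1 - 1 / 2 : ℝ) = 1 / 2 := by norm_num
  rw [h12] at hx
  exact hx

/-- **Witness of weakness for the piece's deciding shape:** on every cell the single-cell ladder has a PROVED grade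
(some excess `e`), while the piece asks excess `g − 1` (and the print gives excess `g`). -/
theorem rung_below_singlePg (g : ℕ) : ∃ e : ℕ,
    (∀ f : ℤ[X], IsBatemanHornSystem ![f] → f.natDegree = g →
      ∃ θ : ℝ, 0 < θ ∧ ∀ᶠ x : ℕ in atTop,
        θ * (batemanHornConst ![f] / (f.natDegree : ℝ) * (x : ℝ) / Real.log x) ≤
          (((Finset.range (x + 1)).filter fun n : ℕ =>
            1 < f.eval (n : ℤ) ∧ ArithmeticFunction.cardFactors ((f.eval (n : ℤ)).toNat) ≤ e + 1).card : ℝ)) ∧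
    (SinglePg → 3 ≤ g → ∀ f : ℤ[X], IsBatemanHornSystem ![f] → f.natDegree = g →
      ∃ θ : ℝ, 0 < θ ∧ ∀ᶠ x : ℕ in atTop,
        θ * (batemanHornConst ![f] / (f.natDegree : ℝ) * (x : ℝ) / Real.log x) ≤
          (((Finset.range (x + 1)).filter fun n : ℕ =>
            1 < f.eval (n : ℤ) ∧ ArithmeticFunction.cardFactors ((f.eval (n : ℤ)).toNat) ≤ (g - 1) + 1).card : ℝ)) :=
  let ⟨e, he⟩ := grade_rung g
  ⟨e, he, fun hS hg => singlePg_iff_diagonalGrade.mp hS g hg⟩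

end Summit.Parity.BatemanHorn.Theses.DegreeExcessLadder
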